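import Mathlib.Algebra.Polynomial.BigOperators
import Mathlib.Algebra.Polynomial.Roots
import Mathlib.Algebra.BigOperators.Intervals
import Mathlib.Algebra.Order.Ring.GeomSum
import Mathlib.Topology.Algebra.Polynomial
import Mathlib.Analysis.SpecificLimits.Basic
import HarnessLib

/-!
# Tavenas' family `V_n = ∑_{i < 2^n} 2^{2·2^n·i - 2i(i+1)} X^i`: a `P`-definable family with `2^n - 1` real roots

S. Tavenas (PhD thesis, ENS Lyon 2014, Ch. 3, §2.2 "Avec la définissabilité dans `P`",
Lemme 3.36) observes that the polynomials
`V_n(X) = ∑_{i=0}^{2^n - 1} 2^{2·2^n·i - 2 i (i+1)} X^i ∈ ℤ[X]`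
have only real (and distinct) roots — by Hutchinson's criterion `a_i² > 4 a_{i-1} a_{i+1}`
(Thm. 3.35; here `a_i² = 16 a_{i-1} a_{i+1}`) — while their coefficient bits are computable in
polynomial time (`Bit(v) ∈ P`), so that they can replace the Pochhammer–Wilkinson polynomials
`∏_{i ≤ 2^n} (X - i)` in the transfer theorem "real τ-conjecture ⇒ the permanent is hard"
(Thm. 3.3 / Cor. 3.37 / Thm. 3.38) WITHOUT the counting-hierarchy machinery (Lemma 3.9,
Lemma 3.16) needed for `PW_n` ("la définissabilité dans `P` permet d'éviter de dépendre du
lemme 3.9", thesis p. 54).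

This file defines the family and proves, self-containedly, everything the transfer theorem
consumes:

* `tavenasV n`, `coeff_tavenasV`, `natDegree_tavenasV_lt` (`deg V_n < 2^n`),
  `natAbs_coeff_tavenasV_lt` (`0 ≤ coeff < 2^{2^{2n+1}}`), `map_tavenasV_ne_zero`;
* `card_roots_toFinset_map_tavenasV : #Z_ℝ(V_n) = 2^n - 1` — all roots of `V_n` are real and
  distinct.

About the count: the thesis prints "`V_n` a `2^n` racines réelles distinctes", but
`deg V_n = 2^n - 1`, so the correct (and proved) statement is that `V_n` has exactly `2^n - 1`
distinct real roots, i.e. all of them; nothing downstream needs more.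

## Proof of the root count

Instead of Hutchinson's general theorem we give the direct dominant-term argument for this
family (which is how Hutchinson-type results are proved): with `N = 2^n`, `E_u = N(N-1) + u²`
and the points `x_u = -4^{2u+1} / 4^N` (`u < N`) one has the exact identity
`4^{N(N-1)} V_n(x_u) = ∑_{i<N} (-1)^i 4^{E_u - (i-u)²}` (`pow_mul_eval_xPt`), whose `i = u` term
`4^{E_u}` dominates the others: `∑_{i ≠ u} 4^{E_u - (i-u)²} ≤ ∑_{i≠u} 4^{E_u - |i-u|} < (2/3) 4^{E_u}`
(two geometric series, `three_mul_geom4_add`). Hence `sign V_n(x_u) = (-1)^u`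
(`sign_eval_xPt`), the `x_u` decrease, and the intermediate value theorem yields `N - 1` roots
in the disjoint intervals `(x_{u+1}, x_u)` (`le_card_roots_toFinset_of_alternating`); as
`deg V_n = N - 1` there are no others.

## References

* S. Tavenas, *Bornes inférieures et supérieures dans les circuits arithmétiques*, PhD thesis,
  ENS Lyon 2014, Thm. 3.35 (Hutchinson), Lemme 3.36, Cor. 3.37, Thm. 3.38, §3.2.2 pp. 53–54.
* J. I. Hutchinson, *On a remarkable class of entire functions*, Trans. AMS 25 (1923) 325–332.
-/

noncomputable section

open Polynomial Finset

namespace Literature.Computability.AlgebraicComplexity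

/-! ### The family -/

/-- The exponent `2·2^n·i - 2 i (i+1) = 2 i (2^n - 1 - i)` of the coefficient of `X^i` in `V_n`
(Tavenas 2014, Lemme 3.36; the two closed forms agree for `i < 2^n`, the only relevant range). [cite: Tavenas2014, Lemme 3.36] -/
def vExp (n i : ℕ) : ℕ := 2 * (i * (2 ^ n - 1 - i))

/-- **Tavenas' family** `V_n(X) = ∑_{i=0}^{2^n - 1} 2^{2·2^n·i - 2i(i+1)} X^i ∈ ℤ[X]`
(Tavenas 2014, Lemme 3.36). [cite: Tavenas2014, Lemme 3.36] -/
def tavenasV (n : ℕ) : Polynomial ℤ :=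
  ∑ i ∈ range (2 ^ n), C ((2 : ℤ) ^ vExp n i) * X ^ i

/-- The coefficients of `V_n`: `2^{vExp n i}` for `i < 2^n`, `0` beyond. [cite: Tavenas2014, Lemme 3.36] -/
theorem coeff_tavenasV (n i : ℕ) :
    (tavenasV n).coeff i = if i < 2 ^ n then 2 ^ vExp n i else 0 := by
  simp only [tavenasV, finsetSum_coeff, coeff_C_mul_X_pow]
  rw [Finset.sum_ite_eq]
  simp only [mem_range]

/-- `deg V_n < 2^n` (indeed `= 2^n - 1`). [cite: Tavenas2014, Lemme 3.36] -/
theorem natDegree_tavenasV_lt (n : ℕ) : (tavenasV n).natDegree < 2 ^ n := by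
  have h : (tavenasV n).natDegree ≤ 2 ^ n - 1 := by
    unfold tavenasV
    refine natDegree_sum_le_of_forall_le _ _ fun i hi => ?_
    have := natDegree_C_mul_X_pow_le ((2 : ℤ) ^ vExp n i) i
    have hi' := mem_range.1 hi
    omega
  have := Nat.one_le_two_pow (n := n)
  omega

/-- The exponents are below `2^{2n+1}`: `2 i (2^n - 1 - i) < 2 · 2^n · 2^n`. [folklore] -/
theorem vExp_lt (n i : ℕ) (hi : i < 2 ^ n) : vExp n i < 2 ^ (2 * n + 1) := by
  unfold vExp
  have h1 : i * (2 ^ n - 1 - i) < 2 ^ n * 2 ^ n := by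
    calc i * (2 ^ n - 1 - i) ≤ i * 2 ^ n := Nat.mul_le_mul_left i (by omega)
      _ < 2 ^ n * 2 ^ n := Nat.mul_lt_mul_of_pos_right hi (Nat.two_pow_pos n)
  calc 2 * (i * (2 ^ n - 1 - i)) < 2 * (2 ^ n * 2 ^ n) := by omega
    _ = 2 ^ (2 * n + 1) := by ring

/-- Coefficient bound: `|coeff_i V_n| < 2^{2^{2n+1}}` (the coefficients are powers of two with
exponent `< 2^{2n+1}`). [cite: Tavenas2014, Lemme 3.36] -/
theorem natAbs_coeff_tavenasV_lt (n i : ℕ) :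
    ((tavenasV n).coeff i).natAbs < 2 ^ 2 ^ (2 * n + 1) := by
  rw [coeff_tavenasV]
  split_ifs with h
  · rw [Int.natAbs_pow]
    exact Nat.pow_lt_pow_right (by norm_num) (vExp_lt n i h)
  · simp

/-- The constant coefficient of `V_n` is `1`. [folklore] -/
theorem coeff_tavenasV_zero (n : ℕ) : (tavenasV n).coeff 0 = 1 := by
  rw [coeff_tavenasV, if_pos (Nat.two_pow_pos n)]
  simp [vExp]

/-- `V_n ≠ 0`. [folklore] -/
theorem tavenasV_ne_zero (n : ℕ) : tavenasV n ≠ 0 := fun h => by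
  have := coeff_tavenasV_zero n
  rw [h, coeff_zero] at this
  exact zero_ne_one this

/-- `V_n ≠ 0` in `ℝ[X]`. [folklore] -/
theorem map_tavenasV_ne_zero (n : ℕ) : (tavenasV n).map (Int.castRingHom ℝ) ≠ 0 := fun h => by
  have := congr_arg (fun p : ℝ[X] => p.coeff 0) h
  simp only [coeff_map, coeff_tavenasV_zero, map_one, coeff_zero] at this
  exact one_ne_zero this

/-- `V_n` over `ℝ`, expanded. [folklore] -/
theorem map_tavenasV (n : ℕ) : (tavenasV n).map (Int.castRingHom ℝ) =
    ∑ i ∈ range (2 ^ n), C ((2 : ℝ) ^ vExp n i) * X ^ i := by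
  unfold tavenasV
  rw [Polynomial.map_sum]
  refine Finset.sum_congr rfl fun i _ => ?_
  rw [Polynomial.map_mul, Polynomial.map_pow, map_X, map_C]
  simp

/-! ### The dominant-term computation, in `ℤ` -/

/-- Squared distance `(i - u)²` on `ℕ` (one of the two truncated differences vanishes). [folklore] -/
def sqd (i u : ℕ) : ℕ := (u - i) * (u - i) + (i - u) * (i - u)

/-- `sqd i u = (i - u)²` in `ℤ`. [folklore] -/
theorem cast_sqd (i u : ℕ) : ((sqd i u : ℕ) : ℤ) = ((i : ℤ) - u) ^ 2 := by
  unfold sqd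
  rcases le_total i u with h | h
  · rw [Nat.sub_eq_zero_of_le h]; push_cast [h]; ring
  · rw [Nat.sub_eq_zero_of_le h]; push_cast [h]; ring

/-- `sqd u u = 0`. [folklore] -/
@[simp] theorem sqd_self (u : ℕ) : sqd u u = 0 := by simp [sqd]

/-- `u - i ≤ (i - u)²`. [folklore] -/
theorem sub_le_sqd (i u : ℕ) : u - i ≤ sqd i u :=
  (Nat.le_mul_self _).trans (Nat.le_add_right _ _)

/-- `i - u ≤ (i - u)²`. [folklore] -/
theorem sub_le_sqd' (i u : ℕ) : i - u ≤ sqd i u :=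
  (Nat.le_mul_self _).trans (Nat.le_add_left _ _)

/-- `(i - u)² ≤ N(N-1) + u²` for `i, u < N`. [folklore] -/
theorem sqd_le {N i u : ℕ} (hi : i < N) (hu : u < N) : sqd i u ≤ N * (N - 1) + u * u := by
  have h1 : 1 ≤ N := by omega
  zify [h1]
  rw [cast_sqd]
  have hi' : (i : ℤ) ≤ N - 1 := by have : i ≤ N - 1 := by omega
                                   exact_mod_cast this.trans_eq (by omega)
  rcases le_total i u with h | h
  · have h' : (i : ℤ) ≤ u := by exact_mod_cast h
    nlinarith
  · have h' : (u : ℤ) ≤ i := by exact_mod_cast h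
    have hN : (0 : ℤ) ≤ N - 1 := by linarith [(Nat.cast_nonneg i : (0 : ℤ) ≤ i)]
    nlinarith [mul_le_mul hi' hi' (Nat.cast_nonneg i) hN]

/-- The exponent identity behind `4^{N(N-1)} · 2^{vExp} · x_u^i = ± 4^{E_u - (i-u)²}`:
`N(N-1) + i(N-1-i) + (2u+1) i = (N(N-1) + u² - (i-u)²) + N i`. [folklore] -/
theorem expo_identity {N i u : ℕ} (hi : i < N) (hu : u < N) :
    N * (N - 1) + i * (N - 1 - i) + (2 * u + 1) * i = (N * (N - 1) + u * u - sqd i u) + N * i := by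
  have h0 := sqd_le hi hu
  have h1 : 1 ≤ N := by omega
  have h2 : i ≤ N - 1 := by omega
  zify [h0, h1, h2]
  rw [cast_sqd]
  ring

/-- The integer `Z_u = ∑_{i<N} (-1)^i 4^{E_u - (i-u)²}`, `E_u = N(N-1) + u²`. [folklore] -/
def zSum (N u : ℕ) : ℤ := ∑ i ∈ range N, (-1) ^ i * 4 ^ (N * (N - 1) + u * u - sqd i u)

/-- Geometric telescoping: `3 ∑_{k<m} 4^{E-(k+1)} + 4^{E-m} = 4^E` for `m ≤ E`. [folklore] -/
theorem three_mul_geom4_add {E m : ℕ} (hm : m ≤ E) :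
    3 * ∑ k ∈ range m, (4 : ℤ) ^ (E - (k + 1)) + 4 ^ (E - m) = 4 ^ E := by
  induction m with
  | zero => simp
  | succ m ih =>
    rw [sum_range_succ, mul_add, add_assoc, ← ih (by omega)]
    have : (4 : ℤ) ^ (E - m) = 4 ^ (E - (m + 1)) * 4 := by
      rw [← pow_succ]; congr 1; omega
    rw [this]; ring

/-- **The `u`-th term dominates**: `0 < (-1)^u Z_u` for `u < N`. [folklore] -/
theorem zSum_sign {N u : ℕ} (hu : u < N) : 0 < (-1) ^ u * zSum N u := by
  set E : ℕ := N * (N - 1) + u * u with hE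
  have h1N : 1 ≤ N := by omega
  have huE : u ≤ E := (Nat.le_mul_self u).trans (Nat.le_add_left _ _)
  have hNE : N - (u + 1) ≤ E := by
    have : N - (u + 1) ≤ N * (N - 1) := by
      calc N - (u + 1) ≤ N - 1 := by omega
        _ ≤ N * (N - 1) := Nat.le_mul_of_pos_left _ h1N
    exact this.trans (Nat.le_add_right _ _)
  -- the signed terms
  set g : ℕ → ℤ := fun i => (-1) ^ (u + i) * 4 ^ (E - sqd i u) with hg
  have hsum : (-1) ^ u * zSum N u = ∑ i ∈ range N, g i := by
    rw [zSum, mul_sum]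
    refine sum_congr rfl fun i _ => ?_
    simp only [hg, pow_add]; ring
  -- split the range at `u`
  have hsplit : ∑ i ∈ range N, g i = ∑ i ∈ Ico 0 u, g i + (g u + ∑ i ∈ Ico (u + 1) N, g i) := by
    rw [range_eq_Ico, ← sum_Ico_consecutive g (Nat.zero_le u) hu.le, sum_eq_sum_Ico_succ_bot hu]
  have hgu : g u = 4 ^ E := by
    simp only [hg, sqd_self, Nat.sub_zero, ← two_mul, pow_mul, neg_one_sq, one_pow, one_mul]
  -- termwise lower bounds
  have hterm : ∀ i d, d ≤ sqd i u → -(4 : ℤ) ^ (E - d) ≤ g i := by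
    intro i d hd
    have h4 : (4 : ℤ) ^ (E - sqd i u) ≤ 4 ^ (E - d) :=
      pow_le_pow_right₀ (by norm_num) (Nat.sub_le_sub_left hd E)
    have h4' : (0 : ℤ) ≤ 4 ^ (E - sqd i u) := by positivity
    simp only [hg]
    rcases neg_one_pow_eq_or ℤ (u + i) with h | h <;> rw [h] <;> linarith
  have hT₁ : -(∑ i ∈ Ico 0 u, (4 : ℤ) ^ (E - (u - i))) ≤ ∑ i ∈ Ico 0 u, g i := by
    rw [← sum_neg_distrib]
    exact sum_le_sum fun i _ => hterm i _ (sub_le_sqd i u)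
  have hT₂ : -(∑ i ∈ Ico (u + 1) N, (4 : ℤ) ^ (E - (i - u))) ≤ ∑ i ∈ Ico (u + 1) N, g i := by
    rw [← sum_neg_distrib]
    exact sum_le_sum fun i _ => hterm i _ (sub_le_sqd' i u)
  -- the two geometric sums
  have hG₁ : 3 * ∑ i ∈ Ico 0 u, (4 : ℤ) ^ (E - (u - i)) + 4 ^ (E - u) = 4 ^ E := by
    rw [← three_mul_geom4_add huE, ← range_eq_Ico, ← sum_range_reflect _ u]
    congr 2
    refine sum_congr rfl fun i hi => ?_
    have := mem_range.1 hi
    congr 2; omega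
  have hG₂ : 3 * ∑ i ∈ Ico (u + 1) N, (4 : ℤ) ^ (E - (i - u)) + 4 ^ (E - (N - (u + 1))) = 4 ^ E := by
    rw [← three_mul_geom4_add hNE, sum_Ico_eq_sum_range]
    congr 2
    refine sum_congr rfl fun i _ => ?_
    congr 2; omega
  have hp₀ : (0 : ℤ) < 4 ^ E := by positivity
  have hp₁ : (0 : ℤ) < 4 ^ (E - u) := by positivity
  have hp₂ : (0 : ℤ) < 4 ^ (E - (N - (u + 1))) := by positivity
  rw [hsum, hsplit, hgu]
  linarith

/-! ### The evaluation points `x_u = -4^{2u+1}/4^N` -/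

/-- The evaluation points `x_u = -4^{2u+1} / 4^N`. [folklore] -/
def xPt (N u : ℕ) : ℝ := -((4 : ℝ) ^ (2 * u + 1)) / (4 : ℝ) ^ N

/-- The points decrease: `x_{u+1} < x_u`. [folklore] -/
theorem xPt_succ_lt (N u : ℕ) : xPt N (u + 1) < xPt N u := by
  unfold xPt
  rw [neg_div, neg_div, neg_lt_neg_iff]
  refine div_lt_div_of_pos_right ?_ (by positivity)
  exact pow_lt_pow_right₀ (by norm_num) (by omega)

/-- **The exact evaluation**: `4^{N(N-1)} V_n(x_u) = Z_u` for `u < N = 2^n`. [folklore] -/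
theorem pow_mul_eval_xPt (n u : ℕ) (hu : u < 2 ^ n) :
    (4 : ℝ) ^ (2 ^ n * (2 ^ n - 1)) * ((tavenasV n).map (Int.castRingHom ℝ)).eval (xPt (2 ^ n) u) =
      (zSum (2 ^ n) u : ℝ) := by
  set N : ℕ := 2 ^ n with hN
  rw [map_tavenasV, eval_finsetSum, mul_sum, zSum, Int.cast_sum]
  refine sum_congr rfl fun i hi => ?_
  have hi' : i < N := mem_range.1 hi
  rw [eval_mul, eval_C, eval_pow, eval_X]
  push_cast
  -- `2^{vExp} = 4^{i(N-1-i)}`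
  have h2 : (2 : ℝ) ^ vExp n i = 4 ^ (i * (N - 1 - i)) := by
    rw [vExp, ← hN, pow_mul]; norm_num
  have key : (4 : ℝ) ^ (N * (N - 1)) * 4 ^ (i * (N - 1 - i)) * 4 ^ ((2 * u + 1) * i) =
      4 ^ (N * (N - 1) + u * u - sqd i u) * 4 ^ (N * i) := by
    rw [← pow_add, ← pow_add, ← pow_add, expo_identity hi' hu]
  have h4c : (4 : ℝ) ^ (N * i) ≠ 0 := by positivity
  rw [h2, xPt, div_pow, neg_pow, ← pow_mul, ← pow_mul]
  have hre : (4 : ℝ) ^ (N * (N - 1)) * (4 ^ (i * (N - 1 - i)) * ((-1) ^ i * 4 ^ ((2 * u + 1) * i) / 4 ^ (N * i)))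
      = (-1) ^ i * (4 ^ (N * (N - 1)) * 4 ^ (i * (N - 1 - i)) * 4 ^ ((2 * u + 1) * i)) / 4 ^ (N * i) := by
    ring
  rw [hre, key, ← mul_assoc, mul_div_cancel_right₀ _ h4c]

/-- **Sign alternation**: `0 < (-1)^u V_n(x_u)` for `u < 2^n`. [cite: Tavenas2014, Lemme 3.36] -/
theorem sign_eval_xPt (n u : ℕ) (hu : u < 2 ^ n) :
    0 < (-1 : ℝ) ^ u * ((tavenasV n).map (Int.castRingHom ℝ)).eval (xPt (2 ^ n) u) := by
  have h := zSum_sign hu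
  have h' : (0 : ℝ) < (((-1) ^ u * zSum (2 ^ n) u : ℤ) : ℝ) := by exact_mod_cast h
  rw [Int.cast_mul, Int.cast_pow, Int.cast_neg, Int.cast_one, ← pow_mul_eval_xPt n u hu,
    mul_left_comm] at h'
  exact (mul_pos_iff_of_pos_left (by positivity)).1 h'

/-! ### From sign alternation to distinct real roots -/

/-- **Alternating signs at decreasing points give distinct roots**: if `p ≠ 0` and
`(-1)^u p(x_u) > 0` for `u ≤ M` along a strictly decreasing sequence `x`, then `p` has at least
`M` distinct real roots (one in each interval `(x_{u+1}, x_u)`, by the intermediate value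
theorem). [folklore] -/
theorem le_card_roots_toFinset_of_alternating (p : ℝ[X]) (hp : p ≠ 0) (x : ℕ → ℝ) (M : ℕ)
    (hx : ∀ u, x (u + 1) < x u) (hs : ∀ u, u ≤ M → 0 < (-1 : ℝ) ^ u * p.eval (x u)) :
    M ≤ p.roots.toFinset.card := by
  classical
  -- a root in each interval
  have hroot : ∀ u, u < M → ∃ r, x (u + 1) < r ∧ r < x u ∧ p.IsRoot r := by
    intro u hu
    have h0 := hs u hu.le
    have h1 := hs (u + 1) hu
    rw [pow_succ] at h1
    have hcont := p.continuousOn (s := Set.Icc (x (u + 1)) (x u))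
    rcases neg_one_pow_eq_or ℝ u with h | h
    · rw [h] at h0 h1
      have ha : p.eval (x (u + 1)) < 0 := by linarith
      have hb : 0 < p.eval (x u) := by linarith
      obtain ⟨r, hr, hr0⟩ := intermediate_value_Ioo (hx u).le hcont ⟨ha, hb⟩
      exact ⟨r, hr.1, hr.2, hr0⟩
    · rw [h] at h0 h1
      have ha : 0 < p.eval (x (u + 1)) := by linarith
      have hb : p.eval (x u) < 0 := by linarith
      obtain ⟨r, hr, hr0⟩ := intermediate_value_Ioo' (hx u).le hcont ⟨hb, ha⟩
      exact ⟨r, hr.1, hr.2, hr0⟩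
  choose! r hr using hroot
  have hanti : StrictAnti x := strictAnti_nat_of_succ_lt hx
  -- the roots are distinct
  have hinj : Set.InjOn r (range M : Set ℕ) := by
    intro u hu v hv huv
    have hu' : u < M := by simpa using hu
    have hv' : v < M := by simpa using hv
    by_contra hne
    rcases lt_or_gt_of_ne hne with h | h
    · have h1 : x v ≤ x (u + 1) := hanti.antitone (by omega)
      have := (hr v hv').2.1
      have := (hr u hu').1
      linarith
    · have h1 : x u ≤ x (v + 1) := hanti.antitone (by omega)
      have := (hr u hu').2.1
      have := (hr v hv').1
      linarith
  have hsub : (range M).image r ⊆ p.roots.toFinset := by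
    intro y hy
    obtain ⟨u, hu, rfl⟩ := mem_image.1 hy
    rw [Multiset.mem_toFinset, mem_roots hp]
    exact (hr u (by simpa using hu)).2.2
  calc M = ((range M).image r).card := by rw [card_image_of_injOn hinj, card_range]
    _ ≤ p.roots.toFinset.card := card_le_card hsub

/-- **Tavenas' Lemme 3.36 (corrected count): `V_n` has exactly `2^n - 1` distinct real roots**,
i.e. all its roots are real and simple (thesis: "`2^n` racines réelles distinctes", but
`deg V_n = 2^n - 1`). [cite: Tavenas2014, Lemme 3.36] -/
theorem card_roots_toFinset_map_tavenasV (n : ℕ) :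
    ((tavenasV n).map (Int.castRingHom ℝ)).roots.toFinset.card = 2 ^ n - 1 := by
  apply le_antisymm
  · calc ((tavenasV n).map (Int.castRingHom ℝ)).roots.toFinset.card
        ≤ Multiset.card ((tavenasV n).map (Int.castRingHom ℝ)).roots := Multiset.toFinset_card_le _
      _ ≤ ((tavenasV n).map (Int.castRingHom ℝ)).natDegree := card_roots' _
      _ ≤ (tavenasV n).natDegree := natDegree_map_le
      _ ≤ 2 ^ n - 1 := by have := natDegree_tavenasV_lt n; omega
  · refine le_card_roots_toFinset_of_alternating _ (map_tavenasV_ne_zero n) (xPt (2 ^ n)) _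
      (xPt_succ_lt (2 ^ n)) fun u hu => sign_eval_xPt n u ?_
    have := Nat.one_le_two_pow (n := n)
    omega

/-- At least `2^n - 1` distinct real roots (the form consumed by the transfer theorem). [cite: Tavenas2014, Lemme 3.36] -/
theorem le_card_roots_toFinset_map_tavenasV (n : ℕ) :
    2 ^ n - 1 ≤ ((tavenasV n).map (Int.castRingHom ℝ)).roots.toFinset.card :=
  (card_roots_toFinset_map_tavenasV n).ge

end Literature.Computability.AlgebraicComplexity
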